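import Mathlib.Analysis.Calculus.Deriv.MeanValue
import Literature.Geometry.Lorentzian.KerrDeSitterTeukolskyRadial
import HarnessLib

/-!
# Venture KdS — the horizons of the pilot box `B0` in the kernel: `Δ_r` has exactly the subextremal
# sign pattern, with rational enclosures of `r₋, r₊, r_c`, for every `(a, Λ) ∈ [1/2, 251/500] × [1/50, 101/5000]` (`M = 1`)

HONEST FRAMING (venture `Summits/Ventures/KdS`, cell `pub-kds`): elementary real analysis of the
quartic `Δ_r(r) = (r² + a²)(1 − Λr²/3) − 2r` on the pilot parameter box, nothing else. It turns the
"window constants" hypothesis (H4) of the box theorem (`ModeStability.lean`) from engine-enclosed DATA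
into Lean theorems (`WindowConstantsB0.lean`). No claim about mode stability is made here.

Method (uniform in the box): `Δ_r` is increasing in `a²` (for `Λr² < 3`) and decreasing in `Λ` at
fixed `r ≥ 0`, so its sign at a rational `r` is decided by one corner evaluation; `Δ_r' < 0` on
`[0, 1]`, `Δ_r' > 0` on `[11/10, 5]`, `Δ_r' < 0` on `[54/5, ∞)` (crude polynomial bounds), and
`Δ_r > 0` on `[5, 54/5]` directly; with the sign changes `Δ_r(13/100) > 0 > Δ_r(17/125)`,
`Δ_r(19/10) < 0 < Δ_r(39/20)`, `Δ_r(54/5) > 0 > Δ_r(111/10)` and the Kerr comparison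
`Δ_r(r) ≤ r² − 2r + a²` this gives: exactly one zero `r₋ ∈ (13/100, 17/125)`, one `r₊ ∈ (19/10, 39/20)`,
one `r_c ∈ (54/5, 111/10)` on `[0, ∞)`, `Δ_r > 0` on `[0, r₋) ∪ (r₊, r_c)`, `Δ_r < 0` on
`(r₋, r₊) ∪ (r_c, ∞)`; hence the tree's `rMinus/rPlus/rCosmo` (defined by `sInf/sSup`) ARE these
zeros and `IsSubextremal 1 a Λ` holds (`isSubextremal_B0`), with the enclosures (`horizons_B0`).
-/

noncomputable section

open Set

namespace Summit.Ventures.KdS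

open Literature.Geometry.Lorentzian Literature.Geometry.Lorentzian.KerrDeSitter

/-! ### `Δ_r` at `M = 1`: formula, derivative, elementary bounds -/

/-- `Δ_r` at `M = 1`. -/
theorem delta_one (a Λ r : ℝ) :
    delta 1 a Λ r = (r ^ 2 + a ^ 2) * (1 - Λ / 3 * r ^ 2) - 2 * r := by
  unfold delta; ring

/-- `Δ_r'` at `M = 1`. -/
theorem deltaDeriv_one (a Λ r : ℝ) :
    deltaDeriv 1 a Λ r = 2 * r - 4 * Λ / 3 * r ^ 3 - 2 * Λ / 3 * a ^ 2 * r - 2 := by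
  unfold deltaDeriv; ring

/-- `Δ_r` is continuous in `r`. -/
theorem continuous_delta (M a Λ : ℝ) : Continuous fun r => delta M a Λ r := by
  unfold delta; fun_prop

/-- `deriv Δ_r = Δ_r'`. -/
theorem deriv_delta (M a Λ : ℝ) :
    deriv (fun r => delta M a Λ r) = fun r => deltaDeriv M a Λ r :=
  funext fun r => (hasDerivAt_delta M a Λ r).deriv

/-- Kerr comparison: `Δ_r(r) ≤ r² − 2r + a²` for `Λ ≥ 0` (`M = 1`). -/
theorem delta_le_kerr {Λ : ℝ} (hΛ : 0 ≤ Λ) (a r : ℝ) :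
    delta 1 a Λ r ≤ r ^ 2 - 2 * r + a ^ 2 := by
  rw [delta_one]
  nlinarith [mul_nonneg (mul_nonneg hΛ (sq_nonneg r)) (add_nonneg (sq_nonneg r) (sq_nonneg a))]

/-- Monotonicity of `Δ_r` in the parameters at fixed `r`: increasing in `a²` when `Λr² ≤ 3`,
decreasing in `Λ` — so a lower bound holds at the corner `(a_min, Λ_max)` and an upper bound at
`(a_max, Λ_min)`. Lower-corner form. -/
theorem delta_corner_lower {a Λ a₀ Λ₁ r : ℝ} (ha : a₀ ≤ a) (ha₀ : 0 ≤ a₀) (hΛ : Λ ≤ Λ₁)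
    (hr : Λ₁ * r ^ 2 ≤ 3) :
    (r ^ 2 + a₀ ^ 2) * (1 - Λ₁ / 3 * r ^ 2) - 2 * r ≤ delta 1 a Λ r := by
  rw [delta_one]
  have h1 : a₀ ^ 2 ≤ a ^ 2 := pow_le_pow_left₀ ha₀ ha 2
  have h2 : 0 ≤ 1 - Λ₁ / 3 * r ^ 2 := by nlinarith
  have h3 : 0 ≤ (r ^ 2 + a ^ 2) * r ^ 2 := by positivity
  nlinarith [mul_le_mul_of_nonneg_right h1 h2, mul_le_mul_of_nonneg_right hΛ h3]

/-- Upper-corner form of the parameter monotonicity. -/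
theorem delta_corner_upper {a Λ a₁ Λ₀ r : ℝ} (ha : a ≤ a₁) (ha0 : 0 ≤ a) (hΛ : Λ₀ ≤ Λ)
    (hr : Λ * r ^ 2 ≤ 3) :
    delta 1 a Λ r ≤ (r ^ 2 + a₁ ^ 2) * (1 - Λ₀ / 3 * r ^ 2) - 2 * r := by
  rw [delta_one]
  have h1 : a ^ 2 ≤ a₁ ^ 2 := pow_le_pow_left₀ ha0 ha 2
  have h2 : 0 ≤ 1 - Λ / 3 * r ^ 2 := by nlinarith
  have h3 : 0 ≤ (r ^ 2 + a₁ ^ 2) * r ^ 2 := by positivity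
  nlinarith [mul_le_mul_of_nonneg_right h1 h2, mul_le_mul_of_nonneg_right hΛ h3]

section Box

/-! ### The box hypotheses and the sign pattern -/

variable {a Λ : ℝ} (ha : 1 / 2 ≤ a ∧ a ≤ 251 / 500) (hΛ : 1 / 50 ≤ Λ ∧ Λ ≤ 101 / 5000)
include ha hΛ

/-- `Δ_r' < 0` on `[0, 1]`. -/
theorem deltaDeriv_neg_low {r : ℝ} (hr0 : 0 ≤ r) (hr1 : r ≤ 1) : deltaDeriv 1 a Λ r < 0 := by
  rw [deltaDeriv_one]
  have hΛ0 : 0 < Λ := by linarith [hΛ.1]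
  have h1 : 0 ≤ Λ * r ^ 3 := by positivity
  have ha0 : 0 ≤ a := by linarith [ha.1]
  have h2 : 0 ≤ Λ * a ^ 2 * r := by positivity
  rcases le_or_gt r (1 / 2) with h | h
  · nlinarith
  · have : (1 / 50) * (1 / 8) ≤ Λ * r ^ 3 := by
      have hr3 : (1 / 8 : ℝ) ≤ r ^ 3 := by
        have := pow_le_pow_left₀ (by norm_num : (0 : ℝ) ≤ 1 / 2) h.le 3
        norm_num at this
        exact this
      exact mul_le_mul hΛ.1 hr3 (by norm_num) hΛ0.le
    nlinarith

/-- `Δ_r' > 0` on `[11/10, 5]`. -/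
theorem deltaDeriv_pos_mid {r : ℝ} (hr0 : 11 / 10 ≤ r) (hr1 : r ≤ 5) : 0 < deltaDeriv 1 a Λ r := by
  rw [deltaDeriv_one]
  have hr : 0 ≤ r := by linarith
  -- replace `Λ` and `a²` by their maxima
  have hL3 : 4 * Λ / 3 * r ^ 3 ≤ 4 * (101 / 5000) / 3 * r ^ 3 := by
    have : 0 ≤ r ^ 3 := by positivity
    nlinarith [hΛ.2]
  have hLa : 2 * Λ / 3 * a ^ 2 * r ≤ 2 * (101 / 5000) / 3 * (251 / 500) ^ 2 * r := by
    have h1 : a ^ 2 ≤ (251 / 500) ^ 2 := pow_le_pow_left₀ (by linarith [ha.1]) ha.2 2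
    have h2 : Λ * a ^ 2 ≤ 101 / 5000 * (251 / 500) ^ 2 :=
      mul_le_mul hΛ.2 h1 (sq_nonneg a) (by norm_num)
    nlinarith [mul_le_mul_of_nonneg_right h2 hr]
  -- a concave cubic, positive at both ends, is positive in between (chord + cubic correction)
  have hcub : 0 ≤ (r - 11 / 10) * (5 - r) * (r + 61 / 10) := by
    have := mul_nonneg (sub_nonneg.2 hr0) (sub_nonneg.2 hr1)
    positivity
  nlinarith [hcub]

/-- `Δ_r' < 0` on `[54/5, ∞)`. -/
theorem deltaDeriv_neg_high {r : ℝ} (hr : 54 / 5 ≤ r) : deltaDeriv 1 a Λ r < 0 := by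
  rw [deltaDeriv_one]
  have hr0 : 0 ≤ r := by linarith
  have ha0 : 0 ≤ a := by linarith [ha.1]
  have hΛ0 : 0 ≤ Λ := by linarith [hΛ.1]
  have h2 : 0 ≤ Λ * a ^ 2 * r := by positivity
  have h3 : (1 / 50) * ((54 / 5) ^ 2 * r) ≤ Λ * r ^ 3 := by
    have : (54 / 5) ^ 2 * r ≤ r ^ 3 := by nlinarith [mul_le_mul hr hr (by norm_num) hr0]
    exact mul_le_mul hΛ.1 this (by positivity) (by linarith [hΛ.1])
  nlinarith

omit ha in
/-- `Δ_r > 0` on `[5, 54/5]` (direct: `Δ_r ≥ r(r(1 − Λr²/3) − 2)` and the concave cubic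
`r − Λr³/3 − 2` is positive at both ends). -/
theorem delta_pos_mid {r : ℝ} (hr0 : 5 ≤ r) (hr1 : r ≤ 54 / 5) : 0 < delta 1 a Λ r := by
  rw [delta_one]
  have hr : 0 ≤ r := by linarith
  have hΛ0 : 0 ≤ Λ := by linarith [hΛ.1]
  have hfac : 0 ≤ 1 - Λ / 3 * r ^ 2 := by nlinarith [hΛ.2, mul_le_mul hr1 hr1 hr (by norm_num)]
  have h1 : r ^ 2 * (1 - Λ / 3 * r ^ 2) - 2 * r ≤ (r ^ 2 + a ^ 2) * (1 - Λ / 3 * r ^ 2) - 2 * r := by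
    nlinarith [mul_nonneg (sq_nonneg a) hfac]
  have hL : Λ / 3 * r ^ 3 ≤ (101 / 5000) / 3 * r ^ 3 := by
    have : 0 ≤ r ^ 3 := by positivity
    nlinarith [hΛ.2]
  have hcub : 0 ≤ (r - 5) * (54 / 5 - r) * (r + 79 / 5) := by
    have := mul_nonneg (sub_nonneg.2 hr0) (sub_nonneg.2 hr1)
    positivity
  have h2 : 2 < r * (1 - Λ / 3 * r ^ 2) := by nlinarith [hcub]
  have h3 : 0 < r ^ 2 * (1 - Λ / 3 * r ^ 2) - 2 * r := by nlinarith
  linarith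

/-- Sign evaluations at the seven rational points (one corner each). -/
theorem delta_signs :
    0 < delta 1 a Λ (13 / 100) ∧ delta 1 a Λ (17 / 125) < 0 ∧ delta 1 a Λ (19 / 10) < 0 ∧
      0 < delta 1 a Λ (39 / 20) ∧ 0 < delta 1 a Λ (54 / 5) ∧ delta 1 a Λ (111 / 10) < 0 := by
  have ha0 : 0 ≤ a := by linarith [ha.1]
  have hΛ0 : 0 ≤ Λ := by linarith [hΛ.1]
  refine ⟨?_, ?_, ?_, ?_, delta_pos_mid hΛ (by norm_num) le_rfl, ?_⟩
  · have h := delta_corner_lower (r := 13 / 100) ha.1 (by norm_num) hΛ.2 (by norm_num)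
    nlinarith [h]
  · have h := delta_le_kerr hΛ0 a (17 / 125)
    have h1 : a ^ 2 ≤ (251 / 500) ^ 2 := pow_le_pow_left₀ ha0 ha.2 2
    nlinarith [h]
  · have h := delta_corner_upper (r := 19 / 10) ha.2 ha0 hΛ.1 (by nlinarith [hΛ.2])
    nlinarith [h]
  · have h := delta_corner_lower (r := 39 / 20) ha.1 (by norm_num) hΛ.2 (by norm_num)
    nlinarith [h]
  · have h := delta_corner_upper (r := 111 / 10) ha.2 ha0 hΛ.1 (by nlinarith [hΛ.2])
    nlinarith [h]

/-- `Δ_r` is strictly decreasing on `[0, 1]`. -/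
theorem delta_strictAntiOn_low : StrictAntiOn (fun r => delta 1 a Λ r) (Icc 0 1) := by
  refine strictAntiOn_of_deriv_neg (convex_Icc 0 1) (continuous_delta 1 a Λ).continuousOn ?_
  intro x hx
  rw [interior_Icc] at hx
  rw [deriv_delta]
  exact deltaDeriv_neg_low ha hΛ hx.1.le hx.2.le

/-- `Δ_r` is strictly increasing on `[11/10, 5]`. -/
theorem delta_strictMonoOn_mid : StrictMonoOn (fun r => delta 1 a Λ r) (Icc (11 / 10) 5) := by
  refine strictMonoOn_of_deriv_pos (convex_Icc _ _) (continuous_delta 1 a Λ).continuousOn ?_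
  intro x hx
  rw [interior_Icc] at hx
  rw [deriv_delta]
  exact deltaDeriv_pos_mid ha hΛ hx.1.le hx.2.le

/-- `Δ_r` is strictly decreasing on `[54/5, ∞)`. -/
theorem delta_strictAntiOn_high : StrictAntiOn (fun r => delta 1 a Λ r) (Ici (54 / 5)) := by
  refine strictAntiOn_of_deriv_neg (convex_Ici _) (continuous_delta 1 a Λ).continuousOn ?_
  intro x hx
  rw [interior_Ici] at hx
  rw [deriv_delta]
  exact deltaDeriv_neg_high ha hΛ hx.le

/-- The three positive zeros with their enclosures and the full sign pattern of `Δ_r` on `[0, ∞)`. -/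
theorem exists_horizons :
    ∃ r₀ r₁ r₂ : ℝ, r₀ ∈ Ioo (13 / 100 : ℝ) (17 / 125) ∧ r₁ ∈ Ioo (19 / 10 : ℝ) (39 / 20) ∧
      r₂ ∈ Ioo (54 / 5 : ℝ) (111 / 10) ∧
      delta 1 a Λ r₀ = 0 ∧ delta 1 a Λ r₁ = 0 ∧ delta 1 a Λ r₂ = 0 ∧
      (∀ r, 0 ≤ r → r < r₀ → 0 < delta 1 a Λ r) ∧
      (∀ r, r₀ < r → r < r₁ → delta 1 a Λ r < 0) ∧
      (∀ r, r₁ < r → r < r₂ → 0 < delta 1 a Λ r) ∧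
      (∀ r, r₂ < r → delta 1 a Λ r < 0) := by
  obtain ⟨s0, s1, s2, s3, s4, s5⟩ := delta_signs ha hΛ
  have hΛ0 : 0 ≤ Λ := by linarith [hΛ.1]
  have ha0 : 0 ≤ a := by linarith [ha.1]
  have hcont := continuous_delta 1 a Λ
  -- the three zeros by the intermediate value theorem
  obtain ⟨r₀, hr₀, hz₀⟩ : ∃ r ∈ Icc (13 / 100 : ℝ) (17 / 125), delta 1 a Λ r = 0 :=
    intermediate_value_Icc' (by norm_num) hcont.continuousOn ⟨s1.le, s0.le⟩
  obtain ⟨r₁, hr₁, hz₁⟩ : ∃ r ∈ Icc (19 / 10 : ℝ) (39 / 20), delta 1 a Λ r = 0 :=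
    intermediate_value_Icc (by norm_num) hcont.continuousOn ⟨s2.le, s3.le⟩
  obtain ⟨r₂, hr₂, hz₂⟩ : ∃ r ∈ Icc (54 / 5 : ℝ) (111 / 10), delta 1 a Λ r = 0 :=
    intermediate_value_Icc' (by norm_num) hcont.continuousOn ⟨s5.le, s4.le⟩
  -- endpoints are not zeros
  have hr₀' : r₀ ∈ Ioo (13 / 100 : ℝ) (17 / 125) := by
    refine ⟨lt_of_le_of_ne hr₀.1 ?_, lt_of_le_of_ne hr₀.2 ?_⟩
    · rintro h; rw [← h] at hz₀; linarith
    · rintro h; rw [h] at hz₀; linarith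
  have hr₁' : r₁ ∈ Ioo (19 / 10 : ℝ) (39 / 20) := by
    refine ⟨lt_of_le_of_ne hr₁.1 ?_, lt_of_le_of_ne hr₁.2 ?_⟩
    · rintro h; rw [← h] at hz₁; linarith
    · rintro h; rw [h] at hz₁; linarith
  have hr₂' : r₂ ∈ Ioo (54 / 5 : ℝ) (111 / 10) := by
    refine ⟨lt_of_le_of_ne hr₂.1 ?_, lt_of_le_of_ne hr₂.2 ?_⟩
    · rintro h; rw [← h] at hz₂; linarith
    · rintro h; rw [h] at hz₂; linarith
  have hlow := delta_strictAntiOn_low ha hΛ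
  have hmid := delta_strictMonoOn_mid ha hΛ
  have hhigh := delta_strictAntiOn_high ha hΛ
  refine ⟨r₀, r₁, r₂, hr₀', hr₁', hr₂', hz₀, hz₁, hz₂, ?_, ?_, ?_, ?_⟩
  · -- `[0, r₀)`: decreasing on `[0,1]` down to `Δ(r₀) = 0`
    intro r h0 h1
    have := hlow ⟨h0, by linarith [hr₀'.2]⟩ ⟨by linarith [hr₀'.1], by linarith [hr₀'.2]⟩ h1
    simpa [hz₀] using this
  · -- `(r₀, r₁)`: `(r₀, 1]` decreasing, `[1, 11/10]` Kerr bound, `[11/10, r₁)` increasing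
    intro r h0 h1
    rcases le_or_gt r 1 with hle | hgt
    · have := hlow ⟨by linarith [hr₀'.1], by linarith [hr₀'.2]⟩ ⟨by linarith [hr₀'.1], hle⟩ h0
      simpa [hz₀] using this
    rcases le_or_gt r (11 / 10) with hle' | hgt'
    · have h := delta_le_kerr hΛ0 a r
      have h1' : a ^ 2 ≤ (251 / 500) ^ 2 := pow_le_pow_left₀ ha0 ha.2 2
      nlinarith
    · have := hmid ⟨hgt'.le, by linarith [hr₁'.2]⟩ ⟨by linarith [hr₁'.1], by linarith [hr₁'.2]⟩ h1
      simpa [hz₁] using this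
  · -- `(r₁, r₂)`: `(r₁, 5]` increasing, `[5, 54/5]` direct, `[54/5, r₂)` decreasing
    intro r h0 h1
    rcases le_or_gt r 5 with hle | hgt
    · have := hmid ⟨by linarith [hr₁'.1], by linarith [hr₁'.2]⟩ ⟨by linarith [hr₁'.1], hle⟩ h0
      simpa [hz₁] using this
    rcases le_or_gt r (54 / 5) with hle' | hgt'
    · exact delta_pos_mid hΛ hgt.le hle'
    · have := hhigh (show (54 / 5 : ℝ) ≤ r from hgt'.le) (show (54 / 5 : ℝ) ≤ r₂ from hr₂.1) h1
      simpa [hz₂] using this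
  · -- `(r₂, ∞)`: decreasing
    intro r h0
    have := hhigh (show (54 / 5 : ℝ) ≤ r₂ from hr₂.1) (show (54 / 5 : ℝ) ≤ r by linarith [hr₂.1]) h0
    simpa [hz₂] using this

/-- The tree's horizon radii ARE the three zeros, `IsSubextremal 1 a Λ` holds, and the enclosures
`rMinus ∈ (13/100, 17/125)`, `rPlus ∈ (19/10, 39/20)`, `rCosmo ∈ (54/5, 111/10)` hold on the box. -/
theorem horizons_B0 :
    IsSubextremal 1 a Λ ∧ rMinus 1 a Λ ∈ Ioo (13 / 100 : ℝ) (17 / 125) ∧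
      rPlus 1 a Λ ∈ Ioo (19 / 10 : ℝ) (39 / 20) ∧ rCosmo 1 a Λ ∈ Ioo (54 / 5 : ℝ) (111 / 10) ∧
      (∀ r, 0 ≤ r → r < rMinus 1 a Λ → 0 < delta 1 a Λ r) := by
  obtain ⟨r₀, r₁, r₂, hr₀, hr₁, hr₂, hz₀, hz₁, hz₂, hA, hB, hC, hD⟩ := exists_horizons ha hΛ
  have h01 : r₀ < r₁ := by linarith [hr₀.2, hr₁.1]
  have h12 : r₁ < r₂ := by linarith [hr₁.2, hr₂.1]
  -- rCosmo = r₂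
  have hc : rCosmo 1 a Λ = r₂ := by
    unfold rCosmo
    refine IsLUB.csSup_eq ⟨?_, ?_⟩ ⟨5, ?_⟩
    · intro r (hr : 0 < delta 1 a Λ r)
      by_contra h
      exact absurd hr (not_lt.mpr (hD r (not_le.mp h)).le)
    · intro b hb
      by_contra h
      rw [not_le] at h
      set r := (max b (54 / 5) + r₂) / 2 with hr_def
      have hr1 : max b (54 / 5) < r := by
        rw [hr_def]; have := max_lt h hr₂.1; linarith
      have hr2 : r < r₂ := by rw [hr_def]; have := max_lt h hr₂.1; linarith
      have hpos : 0 < delta 1 a Λ r := hC r (by linarith [le_max_right b (54 / 5 : ℝ), hr₁.2]) hr2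
      have := hb hpos
      linarith [le_max_left b (54 / 5 : ℝ)]
    · show 0 < delta 1 a Λ 5
      exact hC 5 (by linarith [hr₁.2]) (by linarith [hr₂.1])
  -- rPlus = r₁
  have hp : rPlus 1 a Λ = r₁ := by
    unfold rPlus
    rw [hc]
    refine IsGreatest.csSup_eq ⟨⟨h12, hz₁.le⟩, ?_⟩
    intro r ⟨hrlt, hrle⟩
    by_contra h
    exact absurd hrle (not_le.mpr (hC r (not_le.mp h) hrlt))
  -- rMinus = r₀
  have hm : rMinus 1 a Λ = r₀ := by
    unfold rMinus
    refine IsLeast.csInf_eq ⟨⟨by linarith [hr₀.1], hz₀.le⟩, ?_⟩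
    intro r ⟨hr0, hrle⟩
    by_contra h
    exact absurd hrle (not_le.mpr (hA r hr0.le (not_le.mp h)))
  refine ⟨⟨one_pos, by linarith [hΛ.1], ?_, ?_, ?_, ?_, ?_, ?_, ?_⟩, ?_, ?_, ?_, ?_⟩
  · rw [hm, hp]; exact h01
  · rw [hp, hc]; exact h12
  · rw [hp]; exact hz₁
  · rw [hc]; exact hz₂
  · intro r hr; rw [hm, hp] at hr; exact hB r hr.1 hr.2
  · intro r hr; rw [hp, hc] at hr; exact hC r hr.1 hr.2
  · intro r hr; rw [hc] at hr; exact hD r hr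
  · rw [hm]; exact hr₀
  · rw [hp]; exact hr₁
  · rw [hc]; exact hr₂
  · intro r h0 h1; rw [hm] at h1; exact hA r h0 h1

end Box

end Summit.Ventures.KdS

end
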